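import Mathlib
import Literature.NumberTheory.Transcendental.ZagierDilogarithmConjecture
import Literature.NumberTheory.Transcendental.BlochWignerDilogarithm
import HarnessLib

/-!
# `ZagierDilogarithmConjecture` (stmt-KontsevichZagierPeriods-10550) — line `kummer-clausen-linearisation`
(reshape c5, "the cyclotomic tower and the abelian sector"), stub `stub_allRootsOfUnity_iff`

**The whole roots-of-unity sector of Zagier's conjecture (torsion form) is equivalent to Milnor's
conjecture at every level.** Write `D` for the Bloch–Wigner dilogarithm (`blochWignerDilog`),
`⟨dilogRelators⟩` for the relator group of Zagier's dilogarithm conjecture (Neumann 1998, §2.1) and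
`ζ_N = e^{2πi/N}`. For a level `N ≥ 1` let

* `Sector_N`: every `ℤ`-relation `Σᵢ nᵢ D(uᵢ) = 0` among `N`-th roots of unity `uᵢ` of the open upper half
  plane is explained up to torsion: `M • Σᵢ nᵢ [uᵢ] ∈ ⟨dilogRelators⟩` for some `M ≥ 1`;
* `Milnor_N`: the primitive Clausen values `D(ζ_N^c)`, `c` a unit with `0 < c < N/2`, admit only the trivial
  `ℤ`-relation (Milnor 1982, Appendix).

Assume the level-wise equivalence `Sector_N ↔ Milnor_N` for every `N` (the neighbouring stub
`stub_cyclotomicSectorTorsion_iff` of this line). Then the sector of ALL roots of unity at once — families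
`(uᵢ)` where each `uᵢ` is a root of unity of SOME order `Nᵢ ≥ 1`, `Im uᵢ > 0` — is explained up to torsion
if and only if `Milnor_N` holds for every `N`.

Proof (pure bookkeeping). `⇒`: fix `N`; a family of `N`-th roots of unity is in particular a family of roots
of unity of some order (witness `N`), so the all-orders sector restricts to `Sector_N`, and the level-`N`
equivalence gives `Milnor_N`. `⇐`: given a family with orders `Nᵢ`, pass to the common level
`L = ∏ᵢ Nᵢ ≥ 1`: each `Nᵢ ∣ L`, so `uᵢ ^ L = 1`, and `Sector_L` (from `Milnor_L` by the level-`L`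
equivalence) explains the relation.
Sorry-free; axioms ⊆ {propext, Classical.choice, Quot.sound}.

## References

* W. D. Neumann, *Hilbert's 3rd problem and invariants of 3-manifolds*, Geom. Topol. Monogr. 1 (1998),
  §2.1. [Neumann1998]
* J. Milnor, *Hyperbolic geometry: the first 150 years*, Bull. AMS 6 (1982), Appendix (the conjecture
  on the values `Л(πc/N)`). [Milnor1982]
-/

noncomputable section

open scoped BigOperators ComplexConjugate
open Literature.NumberTheory.Transcendental

namespace Summit.KontsevichZagierPeriods.HyperbolicBloch.ZagierDilogarithmCyclotomic

/-- A finite family of positive naturals has a positive common multiple, namely their product: every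
member divides `∏ᵢ Nᵢ`, which is positive. [folklore] -/
theorem AllRootsOfUnity.exists_common_level {k : ℕ} (Nf : Fin k → ℕ) (hpos : ∀ i, 0 < Nf i) :
    0 < ∏ i, Nf i ∧ ∀ i, Nf i ∣ ∏ j, Nf j :=
  ⟨Finset.prod_pos fun i _ => hpos i, fun i => Finset.dvd_prod_of_mem Nf (Finset.mem_univ i)⟩

/-- If `u ^ N = 1` and `N ∣ L` then `u ^ L = 1`. [folklore] -/
theorem AllRootsOfUnity.pow_eq_one_of_dvd {u : ℂ} {N L : ℕ} (hu : u ^ N = 1) (hdvd : N ∣ L) :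
    u ^ L = 1 := by
  obtain ⟨t, rfl⟩ := hdvd
  rw [pow_mul, hu, one_pow]

/-- **Stub `stub_allRootsOfUnity_iff` (c5): the unconditional cyclotomic tower.** Assuming the
level-wise equivalence `Sector_N ↔ Milnor_N` for every level `N ≥ 1` (torsion form of Zagier's conjecture
on `μ_N ∩ ℍ⁺` versus `ℤ`-independence of the primitive Clausen values `D(ζ_N^c)`, `c ∈ (ℤ/N)ˣ`,
`0 < c < N/2`), the torsion-form sector of Zagier's conjecture for ALL roots of unity of the upper half
plane (each of some order) holds if and only if Milnor's conjecture holds at every level. `⇒` restricts to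
level `N`; `⇐` passes to the common level `L = ∏ᵢ Nᵢ`. [cite: Milnor1982, Appendix] -/
theorem stub_allRootsOfUnity_iff :
    (∀ (N : ℕ) [NeZero N],
      (∀ (k : ℕ) (u : Fin k → ℂ) (n : Fin k → ℤ), (∀ i, u i ^ N = 1) → (∀ i, 0 < (u i).im) →
          ∑ i, (n i : ℝ) * blochWignerDilog (u i) = 0 →
            ∃ M : ℕ, 0 < M ∧ M • (∑ i, n i • FreeAbelianGroup.of (u i)) ∈ AddSubgroup.closure dilogRelators) ↔
        (∀ m : ZMod N → ℤ, (∀ c, m c ≠ 0 → IsUnit c ∧ 0 < c.val ∧ 2 * c.val < N) →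
          ∑ c : ZMod N, (m c : ℝ) *
              blochWignerDilog (Complex.exp (2 * Real.pi * Complex.I / N) ^ c.val) = 0 →
            ∀ c, m c = 0)) →
    ((∀ (k : ℕ) (u : Fin k → ℂ) (n : Fin k → ℤ), (∀ i, ∃ N : ℕ, 0 < N ∧ u i ^ N = 1) →
        (∀ i, 0 < (u i).im) → ∑ i, (n i : ℝ) * blochWignerDilog (u i) = 0 →
          ∃ M : ℕ, 0 < M ∧ M • (∑ i, n i • FreeAbelianGroup.of (u i)) ∈ AddSubgroup.closure dilogRelators) ↔
      ∀ (N : ℕ) [NeZero N] (m : ZMod N → ℤ), (∀ c, m c ≠ 0 → IsUnit c ∧ 0 < c.val ∧ 2 * c.val < N) →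
        ∑ c : ZMod N, (m c : ℝ) *
            blochWignerDilog (Complex.exp (2 * Real.pi * Complex.I / N) ^ c.val) = 0 →
          ∀ c, m c = 0) := by
  intro H
  constructor
  · -- `⇒`: restrict the all-orders sector to level `N`, then use the level-`N` equivalence.
    intro hAll N _
    exact (H N).1 fun k u n hu him hsum =>
      hAll k u n (fun i => ⟨N, Nat.pos_of_ne_zero (NeZero.ne N), hu i⟩) him hsum
  · -- `⇐`: pass to the common level `L = ∏ᵢ Nᵢ` and use `Sector_L`, i.e. `Milnor_L`.
    intro hMil k u n hu him hsum
    choose Nf hNpos hNpow using hu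
    obtain ⟨hL, hdvd⟩ := AllRootsOfUnity.exists_common_level Nf hNpos
    haveI : NeZero (∏ j, Nf j) := ⟨hL.ne'⟩
    exact (H (∏ j, Nf j)).2 (hMil (∏ j, Nf j)) k u n
      (fun i => AllRootsOfUnity.pow_eq_one_of_dvd (hNpow i) (hdvd i)) him hsum

end Summit.KontsevichZagierPeriods.HyperbolicBloch.ZagierDilogarithmCyclotomic

end
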